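import Literature.Probability.LatticeModels.DoubleCurrentsProofs
import Literature.Probability.Percolation.LocalEvents
import Literature.Probability.Percolation.ConnectivityProofs
import Literature.Probability.Percolation.CerfTwoArms
import HarnessLib

/-!
# The infinite-volume double random current of ADS15 and the exit probability

Trunk G02 (T-STATMECH), topic `Probability/LatticeModels`; namespaces `Literature.StatMech`
(definitions) and `Literature.CritIsing` (named facts and the reduction). Fourth layer of the
decomposition of `Literature.Probability.LatticeModels.spontaneousMagnetization_criticalBeta_eq_zero` (`Sharpness.lean`).
After `DoubleCurrentsProofs.lean` (ADS15 (3.10) proved) the only non-classical input of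
`m*(β_c) = 0` (`d ≥ 3`) is the named fact `ads_exitProb_tendsto_zero_of_lroTildeSq`
(`DoubleCurrents.lean`): "`M̃_LRO(β) = 0 ⇒ limsup_L ℙ_{Λ_L,β}[x ↔ δ] = 0`", a finite-volume reading
of three infinite-volume statements of

* M. Aizenman, H. Duminil-Copin, V. Sidoravicius, *Random currents and continuity of Ising
  model's spontaneous magnetization*, Comm. Math. Phys. **334** (2015) 719–742
  (arXiv:1311.1937v3 numbering; bib key `AizenmanDuminilCopinSidoraviciusCMP2015`, "ADS15"):
  Thm. 2.3 (R1: the finite-volume currents converge on events depending on finitely many edges;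
  R2: the limits are translation invariant), §2.3 ("Define `ℙ_β` to be the law of `n̂₁+n₂` …
  `ℙ_β` is invariant and ergodic"; proof of Lemma 2.6: "Property R1 shows that `ℙ_{Λ_n,β}`
  converges weakly to `ℙ_β`"), and Thm. 3.1 ("for `β` at which `M̃_LRO(β) = 0`, also
  `ℙ_β[0 ↔ ∞] = 0`", whose proof uses the uniqueness of the infinite cluster, Thm. 2.5).

This file **defines the infinite-volume double current `ℙ_β`** (`adsDoubleCurrentLawInf`, the
weak limit of `ℙ_{Λ_L,β} = adsDoubleCurrentLaw d L β` on local events when it exists, junk `0`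
otherwise; unique when it exists, `IsAdsLimit.unique`), vendors the three statements as named
facts about it —

* `ads_doubleCurrent_limit_exists` (Thm. 2.3 R1 + §2.3: the weak limit exists),
* `ads_doubleCurrent_shift_invariant` (Thm. 2.3 R2 + §2.3: `ℙ_β` is shift invariant),
* `ads_percolatesAt_zero_of_lroTildeSq` (Thm. 3.1: `M̃_LRO(β) = 0 ⇒ ℙ_β[0 ↔ ∞] = 0`),

— and **proves `ads_exitProb_tendsto_zero_of_lroTildeSq` from them**
(`ads_exitProb_tendsto_zero_of_lroTildeSq_of_infinite`), formalising the parenthetical remark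
after (3.11): "justifying passing to the limit is straightforward by first considering the events
that `x` is connected to distance `N`". Concretely, with the local decreasing events
`B_N = {x ↔ (x+Λ_N)ᶜ through bonds touching x+Λ_N}` (`exitBoxEvent`):
`ℙ_{Λ_L,β}[x ↔ δ] ≤ ℙ_{Λ_L,β}[B_N] → ℙ_β[B_N]` (R1) and `ℙ_β[B_N] ↓ ℙ_β[⋂_N B_N] ≤ ℙ_β[x ↔ ∞]
= ℙ_β[0 ↔ ∞] = 0` (R2, Thm. 3.1).

Consequence: `m*(β_c) = 0` in `d ≥ 3` from these three facts and the classical inputs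
(`spontaneousMagnetization_criticalBeta_eq_zero_of_infiniteCurrents`).

## Mathlib status

Anchors: `MeasureTheory.tendsto_measure_iInter_atTop`, `MeasurableEquiv.map_apply`,
`Filter.Tendsto`, `Set.Finite` / `Filter.eventually_all_finite`; tree: `IsLocalEvent`,
`DeterminedBy`, `measurableSet_of_isLocalEvent_holds` (`PercolationEvents.lean`),
`ext_of_isLocalEvent` (`LocalEvents.lean`), `shiftedBox`, `mem_shiftedBox_iff`
(`CerfTwoArms.lean`), `image_add_box_subset` (`SiteConnectionTools.lean`), `BondConfig.relabel`,
`sym2Equiv`, `Site.shift`, `preimage_relabel_shift_percolatesAt` (`BondPercolationSymmetry.lean`,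
`ConnectivityProofs.lean`), `percolatesAt` (`Percolation.lean`).
-/

noncomputable section

open MeasureTheory Filter Topology Finset Literature.Probability.LatticeModels Literature.Probability.Percolation
open Literature.Probability.Percolation (shiftedBox mem_shiftedBox_iff)
open scoped symmDiff

namespace Literature.Probability.LatticeModels

variable (d : ℕ)

/-! ### The infinite-volume double current `ℙ_β` -/

/-- `μ` **is the infinite-volume double current at `β`**: a probability measure on bond
configurations of `ℤ^d` to which the double currents of the boxes `ℙ_{Λ_L,β}` converge on every
local event (event depending on finitely many edges) — ADS15 Thm. 2.3 (R1) for the pair of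
currents, read on the trace `n̂₁ + n₂` as in §2.3 and the proof of Lemma 2.6 ("`ℙ_{Λ_n,β}`
converges weakly to `ℙ_β`"). Such a `μ` is unique when it exists (`IsAdsLimit.unique`: local events form a
π-system generating the product σ-algebra). [cite: AizenmanDuminilCopinSidoraviciusCMP2015, Thm. 2.3 and §2.3] -/
structure IsAdsLimit (β : ℝ) (μ : Measure (BondConfig (Site d))) : Prop where
  /-- `ℙ_β` is a probability measure. -/
  isProbabilityMeasure : IsProbabilityMeasure μ
  /-- R1: convergence on local events. -/
  tendsto_local : ∀ A : Set (BondConfig (Site d)), IsLocalEvent A →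
    Tendsto (fun L : ℕ => (adsDoubleCurrentLaw d L β).real A) atTop (𝓝 (μ.real A))

open Classical in
/-- **The infinite-volume double random current `ℙ_β`** of ADS15 §2.3 (the law of `n̂₁ + n₂` for
independent infinite-volume sourceless free and plus currents), realised as the weak limit of the
finite-volume double currents `ℙ_{Λ_L,β}` on local events (ADS15 Thm. 2.3 R1, proof of
Lemma 2.6); **junk value** `0` if no such limit exists (its existence for `β > 0` is the named fact
`Literature.Probability.LatticeModels.ads_doubleCurrent_limit_exists`). [cite: AizenmanDuminilCopinSidoraviciusCMP2015, §2.3 and Thm. 2.3] -/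
def adsDoubleCurrentLawInf (β : ℝ) : Measure (BondConfig (Site d)) :=
  if h : ∃ μ, IsAdsLimit d β μ then h.choose else 0

/-- If the weak limit exists, `adsDoubleCurrentLawInf` is one. [cite: AizenmanDuminilCopinSidoraviciusCMP2015, §2.3 and Thm. 2.3] -/
theorem isAdsLimit_adsDoubleCurrentLawInf {β : ℝ} (h : ∃ μ, IsAdsLimit d β μ) :
    IsAdsLimit d β (adsDoubleCurrentLawInf d β) := by
  rw [adsDoubleCurrentLawInf, dif_pos h]
  exact h.choose_spec

/-- **The infinite-volume double current is unique** when it exists: two probability measures to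
which `ℙ_{Λ_L,β}` converges on all local events agree on the π-system of local events, which
generates the σ-algebra (`ext_of_isLocalEvent`, `LocalEvents.lean`). [folklore] -/
theorem IsAdsLimit.unique {β : ℝ} {μ ν : Measure (BondConfig (Site d))} (hμ : IsAdsLimit d β μ)
    (hν : IsAdsLimit d β ν) : μ = ν := by
  haveI := hμ.isProbabilityMeasure
  haveI := hν.isProbabilityMeasure
  refine ext_of_isLocalEvent fun A hA => ?_
  have h := tendsto_nhds_unique (hμ.tendsto_local A hA) (hν.tendsto_local A hA)
  rw [measureReal_def, measureReal_def] at h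
  exact (ENNReal.toReal_eq_toReal_iff' (measure_ne_top μ A) (measure_ne_top ν A)).1 h

/-- Hence for `β` at which the limit exists, `adsDoubleCurrentLawInf d β` **is** the limit of the
finite-volume double currents: any `μ` with `IsAdsLimit d β μ` equals it. [cite: AizenmanDuminilCopinSidoraviciusCMP2015, §2.3 and Thm. 2.3] -/
theorem IsAdsLimit.eq_adsDoubleCurrentLawInf {β : ℝ} {μ : Measure (BondConfig (Site d))}
    (hμ : IsAdsLimit d β μ) : μ = adsDoubleCurrentLawInf d β :=
  hμ.unique d (isAdsLimit_adsDoubleCurrentLawInf d ⟨μ, hμ⟩)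

/-- The shift `ω ↦ ω + v` of bond configurations of `ℤ^d` (`s(x,y) ↦ s(x+v, y+v)`), the tree's
`BondConfig.relabel (sym2Equiv (Site.shift v))` as used for `P_p` in
`BondPercolationSymmetry.lean`. [folklore] -/
abbrev bondShift (v : Site d) : BondConfig (Site d) ≃ᵐ BondConfig (Site d) :=
  BondConfig.relabel (sym2Equiv (Site.shift v))

/-! ### The events "`x` is connected to distance `N`" -/

/-- The translated boxes `x + Λ_N` (`shiftedBox x N`, `CerfTwoArms.lean`) increase with `N`. [folklore] -/
theorem shiftedBox_mono_right (x : Site d) : Monotone (shiftedBox x) := fun _ _ h _ hy =>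
  mem_shiftedBox_iff.2 (box_mono d h (mem_shiftedBox_iff.1 hy))

/-- A finite set of sites lies in some translated box around `x`. [folklore] -/
theorem exists_subset_shiftedBox_of_finite (x : Site d) {S : Set (Site d)} (hS : S.Finite) :
    ∃ N : ℕ, S ⊆ ↑(shiftedBox x N) := by
  have h : ∀ᶠ N : ℕ in atTop, ∀ y ∈ S, y ∈ shiftedBox x N := by
    rw [eventually_all_finite hS]
    intro y _
    filter_upwards [eventually_mem_box (y - x)] with N hN
    exact mem_shiftedBox_iff.2 hN
  obtain ⟨N, hN⟩ := h.exists
  exact ⟨N, fun y hy => hN y hy⟩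

/-- **"`x` is connected to distance `N`"** (ADS15 §3.2, remark after (3.11)): the open cluster of
`x`, explored through the lattice bonds touching `x + Λ_N`, reaches a vertex outside `x + Λ_N`.
A local event (it depends only on the bonds of `ℰ^b_{x+Λ_N}`), decreasing in `N`, containing — on
lattice configurations `ω ⊆ E(ℤ^d)` — the exit event `x ↔ δ` of every larger box, and whose
intersection over `N` is contained in `{x ↔ ∞}`. Here `x + Λ_N` is `shiftedBox x N`
(`CerfTwoArms.lean`). [cite: AizenmanDuminilCopinSidoraviciusCMP2015, §3.2, remark after (3.11)] -/
def exitBoxEvent (x : Site d) (N : ℕ) : Set (BondConfig (Site d)) :=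
  {ω | ∃ v, v ∉ shiftedBox x N ∧
    (openGraph (ω ∩ ↑(edgesTouching (zdGraph d) (shiftedBox x N)))).Reachable x v}

/-- `exitBoxEvent x N` is determined by the bonds touching `x + Λ_N`. [folklore] -/
theorem determinedBy_exitBoxEvent (x : Site d) (N : ℕ) :
    DeterminedBy (exitBoxEvent d x N) ↑(edgesTouching (zdGraph d) (shiftedBox x N)) := by
  rw [determinedBy_iff]
  intro ω ω' h
  simp only [exitBoxEvent, Set.mem_setOf_eq, h]

/-- `exitBoxEvent x N` is a local event. [folklore] -/
theorem isLocalEvent_exitBoxEvent (x : Site d) (N : ℕ) : IsLocalEvent (exitBoxEvent d x N) :=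
  ⟨edgesTouching (zdGraph d) (shiftedBox x N), determinedBy_exitBoxEvent d x N⟩

/-- `exitBoxEvent x N` is measurable. [folklore] -/
theorem measurableSet_exitBoxEvent (x : Site d) (N : ℕ) : MeasurableSet (exitBoxEvent d x N) :=
  measurableSet_of_isLocalEvent_holds (isLocalEvent_exitBoxEvent d x N)

/-- **First exit**: an open path of lattice bonds from `x ∈ S` to a vertex outside the finite set
`S` reaches some vertex outside `S` using only bonds touching `S` (stop at the first vertex
outside `S`). [folklore] -/
theorem exists_reachable_inter_edgesTouching {V : Type*} [DecidableEq V] (G₀ : SimpleGraph V)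
    [G₀.LocallyFinite] (S : Finset V) {ω : BondConfig V} (hω : ω ⊆ G₀.edgeSet) {x v : V}
    (hx : x ∈ S) (hv : v ∉ S) (h : (openGraph ω).Reachable x v) :
    ∃ u, u ∉ S ∧ (openGraph (ω ∩ ↑(edgesTouching G₀ S))).Reachable x u := by
  obtain ⟨p⟩ := h
  induction p with
  | nil => exact absurd hx hv
  | @cons a w b haw p ih =>
    -- the first bond `{a, w}` touches `S` since `a ∈ S`
    have hadj : (openGraph (ω ∩ ↑(edgesTouching G₀ S))).Adj a w := by
      rw [openGraph_adj] at haw ⊢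
      refine ⟨⟨haw.1, ?_⟩, haw.2⟩
      rw [Finset.mem_coe, mem_edgesTouching_iff]
      exact ⟨hω haw.1, a, hx, Sym2.mem_mk_left a w⟩
    by_cases hw : w ∈ S
    · obtain ⟨u, hu, hwu⟩ := ih hw hv
      exact ⟨u, hu, hadj.reachable.trans hwu⟩
    · exact ⟨w, hw, hadj.reachable⟩

/-- Lattice bonds touching a set are lattice bonds. [folklore] -/
theorem inter_edgesTouching_subset_edgeSet (S : Finset (Site d)) (ω : BondConfig (Site d)) :
    ω ∩ ↑(edgesTouching (zdGraph d) S) ⊆ (zdGraph d).edgeSet := by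
  rintro e ⟨-, he⟩
  exact (mem_edgesTouching_iff.1 (Finset.mem_coe.1 he)).1

/-- The events `exitBoxEvent x N` decrease in `N`. [cite: AizenmanDuminilCopinSidoraviciusCMP2015, §3.2, remark after (3.11)] -/
theorem exitBoxEvent_antitone (x : Site d) : Antitone (exitBoxEvent d x) := by
  intro N N' hNN' ω hω
  obtain ⟨v, hv, hxv⟩ := hω
  have hv' : v ∉ shiftedBox x N := fun h => hv (shiftedBox_mono_right d x hNN' h)
  have hx : x ∈ shiftedBox x N := mem_shiftedBox_iff.2 (by rw [sub_self]; exact zero_mem_box d N)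
  obtain ⟨u, hu, hxu⟩ := exists_reachable_inter_edgesTouching (zdGraph d) (shiftedBox x N)
    (inter_edgesTouching_subset_edgeSet d _ ω) hx hv' hxv
  refine ⟨u, hu, hxu.mono (openGraph_mono ?_)⟩
  rintro e ⟨⟨he, -⟩, he'⟩
  exact ⟨he, he'⟩

/-- If `x` is connected to distance `N` for every `N`, its open cluster is infinite:
`⋂_N exitBoxEvent x N ⊆ {x ↔ ∞}`. [cite: AizenmanDuminilCopinSidoraviciusCMP2015, §3.2, remark after (3.11)] -/
theorem iInter_exitBoxEvent_subset_percolatesAt (x : Site d) :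
    ⋂ N, exitBoxEvent d x N ⊆ percolatesAt x := by
  intro ω hω
  rw [Set.mem_iInter] at hω
  by_contra hfin
  have hfin' : (openCluster ω x).Finite := Set.not_infinite.1 hfin
  obtain ⟨N, hN⟩ := exists_subset_shiftedBox_of_finite d x hfin'
  obtain ⟨v, hv, hxv⟩ := hω N
  have hvC : v ∈ openCluster ω x := hxv.mono (openGraph_mono Set.inter_subset_left)
  exact hv (Finset.mem_coe.1 (hN hvC))

/-- The traces of the box currents are lattice bond configurations. [folklore] -/
theorem liftBonds_traced_subset_edgeSet {L : ℕ}
    (p : Current (freeBoxGraph d L) × Current (plusBoxGraph d L)) :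
    liftBonds d L (p.1.traced ∪ p.2.traced) ⊆ (zdGraph d).edgeSet := by
  rintro e ⟨e', he', rfl⟩
  induction e' using Sym2.ind with
  | _ a b =>
    rw [Sym2.map_mk, SimpleGraph.mem_edgeSet]
    rcases he' with h | h
    · obtain ⟨hG, -⟩ := h
      exact ((SimpleGraph.mem_edgeSet _).1 (SimpleGraph.mem_edgeFinset.1 hG)).1
    · obtain ⟨hG, -⟩ := h
      exact ((SimpleGraph.mem_edgeSet _).1 (SimpleGraph.mem_edgeFinset.1 hG)).1

/-- **The exit event of a large box is contained in "`x` is connected to distance `N`"**, on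
lattice configurations: if `x + Λ_N ⊆ Λ_L` and `ω ⊆ E(ℤ^d)`, then `x ↔ δ` (in `Λ_L`) implies
`ω ∈ exitBoxEvent x N`. [cite: AizenmanDuminilCopinSidoraviciusCMP2015, §3.2, remark after (3.11)] -/
theorem exitBoxEvent_of_exitConn {x : Site d} {N L : ℕ} (hNL : shiftedBox x N ⊆ box d L)
    {ω : BondConfig (Site d)} (hω : ω ⊆ (zdGraph d).edgeSet) (h : ω ∈ exitConn d L x) :
    ω ∈ exitBoxEvent d x N := by
  obtain ⟨y, hy, hxy⟩ := h
  exact exists_reachable_inter_edgesTouching (zdGraph d) (shiftedBox x N) hω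
    (mem_shiftedBox_iff.2 (by rw [sub_self]; exact zero_mem_box d N)) (fun h => hy (hNL h)) hxy

/-- **`ℙ_{Λ_L,β}[x ↔ δ] ≤ ℙ_{Λ_L,β}[x` connected to distance `N]`** once `x + Λ_N ⊆ Λ_L`
(`β ≥ 0`): the double current charges only lattice configurations. [cite: AizenmanDuminilCopinSidoraviciusCMP2015, §3.2, remark after (3.11)] -/
theorem adsDoubleCurrentLaw_exitConn_le {β : ℝ} (hβ : 0 ≤ β) {x : Site d} {N L : ℕ}
    (hNL : shiftedBox x N ⊆ box d L) :
    (adsDoubleCurrentLaw d L β).real (exitConn d L x) ≤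
      (adsDoubleCurrentLaw d L β).real (exitBoxEvent d x N) := by
  classical
  have hN := adsPairNorm_pos d L hβ
  rw [adsDoubleCurrentLaw_real_apply d L hβ hN, adsDoubleCurrentLaw_real_apply d L hβ hN]
  have hs : ∀ s : Set (BondConfig (Site d)), Summable fun p : Current (freeBoxGraph d L) ×
      Current (plusBoxGraph d L) => adsPairWeight d L β p / adsPairNorm d L β *
        (if liftBonds d L (p.1.traced ∪ p.2.traced) ∈ s then (1 : ℝ) else 0) := by
    intro s
    have h := (summable_adsPairWeight_mul d L hβ
      (fun p => if liftBonds d L (p.1.traced ∪ p.2.traced) ∈ s then (1 : ℝ) else 0)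
      (fun p => by split_ifs <;> norm_num)).div_const (adsPairNorm d L β)
    refine h.congr fun p => ?_
    ring
  refine Summable.tsum_le_tsum (fun p => ?_) (hs _) (hs _)
  refine mul_le_mul_of_nonneg_left ?_ (div_nonneg (adsPairWeight_nonneg d L hβ p) hN.le)
  by_cases h : liftBonds d L (p.1.traced ∪ p.2.traced) ∈ exitConn d L x
  · rw [if_pos h, if_pos (exitBoxEvent_of_exitConn d hNL (liftBonds_traced_subset_edgeSet d p) h)]
  · rw [if_neg h]; split_ifs <;> norm_num

end Literature.Probability.LatticeModels

namespace Literature.Probability.LatticeModels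

open Percolation

variable {d : ℕ}

/-! ### The three named facts -/

/-- **ADS15 Thm. 2.3 (R1) with §2.3** (Aizenman–Duminil-Copin–Sidoravicius, CMP 334 (2015):
Thm. 2.3 R1 "For any event `𝒜` depending on finitely many edges,
`lim_L P̂^+_{Λ_L,β}[𝒜] = P̂^+_β[𝒜]` and `lim_L P̂^0_{Λ_L,β}[𝒜] = P̂^0_β[𝒜]`"; §2.3 "Define `ℙ_β` to
be the law of `n̂₁+n₂` where `n₁` and `n₂` are two independent currents with laws `P^0_β` and
`P^+_β`"; proof of Lemma 2.6 "Property R1 of Theorem 2.3 shows that `ℙ_{Λ_n,β}` converges weakly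
to `ℙ_β`"). Nearest-neighbour model on `ℤ^d`, `β > 0`, in the ghost-free form of
`DoubleCurrents.lean`: the finite-volume double currents `ℙ_{Λ_L,β}` converge on every local event
to a probability measure. [cite: AizenmanDuminilCopinSidoraviciusCMP2015, Thm. 2.3 (R1) and §2.3, proof of Lemma 2.6] -/
def ads_doubleCurrent_limit_exists : Prop :=
  ∀ ⦃β : ℝ⦄, 0 < β → ∃ μ, IsAdsLimit d β μ

/-- **ADS15 Thm. 2.3 (R2) with §2.3** (Aizenman–Duminil-Copin–Sidoravicius, CMP 334 (2015):
R2 "`P̂^+_β` and `P̂^0_β` are invariant under the shifts `τ_x`, `x ∈ ℤ^d`"; §2.3 "Properties R2 and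
R3 imply immediately that `ℙ_β` is invariant and ergodic with respect to shifts").
Nearest-neighbour model on `ℤ^d`, `β > 0`: the infinite-volume double current `ℙ_β` is invariant
under every lattice translation of the bond configuration. [cite: AizenmanDuminilCopinSidoraviciusCMP2015, Thm. 2.3 (R2) and §2.3] -/
def ads_doubleCurrent_shift_invariant : Prop :=
  ∀ ⦃β : ℝ⦄, 0 < β → ∀ v : Site d,
    (adsDoubleCurrentLawInf d β).map (bondShift d v) = adsDoubleCurrentLawInf d β

/-- **ADS15 Thm. 3.1** (Aizenman–Duminil-Copin–Sidoravicius, CMP 334 (2015), Thm. 3.1: "For `β`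
at which `M̃_LRO(β) = 0`, also `ℙ_β[0 ↔ ∞] = 0`" — proved there from the switching identity
(3.2)–(3.3), the limit (3.4) `ℙ_β[x ↔ y] ≤ ⟨σ_xσ_y⟩⁰_β`, Cauchy–Schwarz and the uniqueness of the
infinite cluster, Thm. 2.5 (Burton–Keane with the insertion tolerance Lemma 2.6 and the ergodicity
R3), giving (3.5) `ℙ_β[0 ↔ ∞]² ≤ M̃_LRO(β)²`). Nearest-neighbour model on `ℤ^d`, `β > 0`: if
`M̃_LRO(β)² = 0` (`lroTildeSq d β = 0`) then the origin percolates with `ℙ_β`-probability zero.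
This is the deep input (infinite-volume random currents, ergodicity, uniqueness of the infinite
cluster). [cite: AizenmanDuminilCopinSidoraviciusCMP2015, Thm. 3.1] -/
def ads_percolatesAt_zero_of_lroTildeSq : Prop :=
  ∀ ⦃β : ℝ⦄, 0 < β → lroTildeSq d β = 0 →
    adsDoubleCurrentLawInf d β (percolatesAt (0 : Site d)) = 0

/-! ### The reduction: `limsup_L ℙ_{Λ_L,β}[x ↔ δ] = 0` -/

/-- **The exit probability vanishes** (ADS15 §3.2, the passage from (3.10) to (3.11): "Taking the
limit `L → ∞` (which exists by Theorem 2.3) … (The percolation event on the right does not depend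
on finitely many edges, but justifying passing to the limit is straightforward by first considering
the events that `x` is connected to distance `N`.) … Applying Theorem 3.1 we conclude that
`ℙ_β[x ↔ ∞] = 0`"). The named fact `ads_exitProb_tendsto_zero_of_lroTildeSq` of
`DoubleCurrents.lean` follows from R1, R2 and Thm. 3.1: for `β > 0` with `M̃_LRO(β) = 0` and every
`x`, `ℙ_{Λ_L,β}[x ↔ δ] ≤ ℙ_{Λ_L,β}[B_N] → ℙ_β[B_N]`, while
`ℙ_β[B_N] ↓ ℙ_β[⋂_N B_N] ≤ ℙ_β[x ↔ ∞] = ℙ_β[0 ↔ ∞] = 0`. [cite: AizenmanDuminilCopinSidoraviciusCMP2015, §3.2, remark after (3.11)] -/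
theorem ads_exitProb_tendsto_zero_of_lroTildeSq_of_infinite
    (hR1 : ads_doubleCurrent_limit_exists (d := d))
    (hR2 : ads_doubleCurrent_shift_invariant (d := d))
    (h31 : ads_percolatesAt_zero_of_lroTildeSq (d := d)) :
    ads_exitProb_tendsto_zero_of_lroTildeSq (d := d) := by
  intro β hβ hM x ε hε
  have hlim := isAdsLimit_adsDoubleCurrentLawInf d (hR1 hβ)
  set μ := adsDoubleCurrentLawInf d β with hμ
  haveI := hlim.isProbabilityMeasure
  -- `ℙ_β[x ↔ ∞] = ℙ_β[0 ↔ ∞] = 0`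
  have hperc : μ (percolatesAt x) = 0 := by
    have h0 : μ (percolatesAt (0 : Site d)) = 0 := h31 hβ hM
    have hpre : (bondShift d (-x)) ⁻¹' (percolatesAt (0 : Site d)) = percolatesAt x := by
      have h := preimage_relabel_shift_percolatesAt (-x) x
      rwa [add_neg_cancel] at h
    rw [← hpre, ← MeasurableEquiv.map_apply, hR2 hβ (-x)]
    exact h0
  -- `ℙ_β[B_N] → ℙ_β[⋂ B_N] = 0`
  set B : ℕ → Set (BondConfig (Site d)) := exitBoxEvent d x with hB
  have hBlim : Tendsto (fun N => μ (B N)) atTop (𝓝 (μ (⋂ N, B N))) :=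
    tendsto_measure_iInter_atTop (fun N => (measurableSet_exitBoxEvent d x N).nullMeasurableSet)
      (exitBoxEvent_antitone d x) ⟨0, measure_ne_top μ _⟩
  have hB0 : μ (⋂ N, B N) = 0 :=
    measure_mono_null (iInter_exitBoxEvent_subset_percolatesAt d x) hperc
  rw [hB0] at hBlim
  have hε2 : (0 : ENNReal) < ENNReal.ofReal (ε / 2) := ENNReal.ofReal_pos.2 (by linarith)
  obtain ⟨N, hN⟩ := (ENNReal.tendsto_nhds_zero.1 hBlim _ hε2).exists
  have hNreal : μ.real (B N) ≤ ε / 2 := by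
    rw [measureReal_def]
    exact ENNReal.toReal_le_of_le_ofReal (by linarith) hN
  -- R1 on the local event `B_N`
  have hconv := hlim.tendsto_local (B N) (isLocalEvent_exitBoxEvent d x N)
  have hev1 : ∀ᶠ L : ℕ in atTop, (adsDoubleCurrentLaw d L β).real (B N) < ε :=
    (tendsto_order.1 hconv).2 ε (by linarith)
  -- the exit event of `Λ_L` is contained in `B_N` for `L` large
  obtain ⟨M, hM'⟩ := (eventually_mem_box x).exists
  have hev2 : ∀ᶠ L : ℕ in atTop, (adsDoubleCurrentLaw d L β).real (exitConn d L x) ≤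
      (adsDoubleCurrentLaw d L β).real (B N) := by
    filter_upwards [eventually_ge_atTop (M + N)] with L hL
    refine adsDoubleCurrentLaw_exitConn_le d hβ.le fun y hy => box_mono d hL ?_
    -- `x + Λ_N ⊆ Λ_{M+N}` (`image_add_box_subset`)
    refine image_add_box_subset hM' (Finset.mem_image.2 ⟨y - x, mem_shiftedBox_iff.1 hy, ?_⟩)
    exact sub_add_cancel y x
  obtain ⟨L₀, hL₀⟩ := (hev1.and hev2).exists_forall_of_atTop
  refine ⟨L₀, fun L hL => ?_⟩
  have h := hL₀ L hL
  linarith [h.1, h.2]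

/-- **The random-current heart from the infinite-volume facts**: R1, R2 and Thm. 3.1 give
`plusPair_eq_freePair_of_lroTildeSq` (`M̃_LRO(β) = 0 ⇒ ⟨σ_xσ_y⟩⁺_β = ⟨σ_xσ_y⟩⁰_β`), the
finite-volume bound (3.10) being proved (`ads_gammaBound_holds`). [cite: AizenmanDuminilCopinSidoraviciusCMP2015, §3.2, eqs. (3.10)–(3.11)] -/
theorem plusPair_eq_freePair_of_lroTildeSq_of_infiniteCurrents
    (hR1 : ads_doubleCurrent_limit_exists (d := d))
    (hR2 : ads_doubleCurrent_shift_invariant (d := d))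
    (h31 : ads_percolatesAt_zero_of_lroTildeSq (d := d)) :
    plusPair_eq_freePair_of_lroTildeSq (d := d) :=
  plusPair_eq_freePair_of_lroTildeSq_of_exitProb
    (ads_exitProb_tendsto_zero_of_lroTildeSq_of_infinite hR1 hR2 h31)

/-- **`m*(β_c) = 0` (`d ≥ 3`) from ADS15 Thm. 2.3 (R1, R2), Thm. 3.1 and the classical inputs.**
The named fact `spontaneousMagnetization_criticalBeta_eq_zero` (`Sharpness.lean`) follows from the
three infinite-volume random-current facts of this file, the existence of the plus state
(`exists_plusMeasure`), the infrared bound (`infraredBound`) and `β_c > 0` (`criticalBeta_pos`);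
all other steps of ADS15 (§2.1 representations, Lemma 2.2, §3.2–3.3) are theorems of the tree. [cite: AizenmanDuminilCopinSidoraviciusCMP2015, Thm. 1.2 with Cor. 1.5] -/
theorem spontaneousMagnetization_criticalBeta_eq_zero_of_infiniteCurrents
    (hR1 : ads_doubleCurrent_limit_exists (d := d))
    (hR2 : ads_doubleCurrent_shift_invariant (d := d))
    (h31 : ads_percolatesAt_zero_of_lroTildeSq (d := d))
    (hplus : ∀ β : ℝ, exists_plusMeasure d (β := β) 0)
    (hIR : ∀ (L : ℕ) [NeZero L], infraredBound (d := d) (L := L))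
    (hβc : criticalBeta_pos (d := d)) :
    spontaneousMagnetization_criticalBeta_eq_zero (d := d) :=
  spontaneousMagnetization_criticalBeta_eq_zero_of_exitProb
    (ads_exitProb_tendsto_zero_of_lroTildeSq_of_infinite hR1 hR2 h31) hplus hIR hβc

end Literature.Probability.LatticeModels
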